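import Literature.InformationTheory.QuantumCodes.BivariateBicycleCodes
import Literature.InformationTheory.QuantumCodes.CSSParameters
import HarnessLib
import HarnessLib.Audit.Tags

/-!
# The five published bivariate-bicycle codes — parameter CLAIMS `[[72,12,6]]`, `[[90,8,10]]`,
# `[[108,8,10]]`, `[[144,12,12]]`, `[[288,12,18]]` (venture QEC, census family BB)

HONEST FRAMING (qec cell, page 1 of every file). Two columns never merge: CERTIFIED = an integer
distance with a kernel-checked certificate (explicit weight-`d` logical + verified infeasibility below
`d`), VALIDATED = Monte Carlo. The published parameters of specific codes are CLAIMS until OUR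
certificate discharges them. NOTHING IN THIS FILE ASSERTS THAT A CLAIM HOLDS: each claim is an
`@[conjecture] def … : Prop` — an obligation node to be proved (`theorem BB72_12_6_claim_holds`) by a
certificate file under `Summits/Ventures/QEC/Census/BB/` through the checker soundness lemma
(PARTITION row type-10) and `hasParams_of_dX` / `hasParams_of_dZ` below, or refuted.

Source of the claims: S. Bravyi, A. W. Cross, J. M. Gambetta, D. Maslov, P. Rall, T. J. Yoder, Nature
**627** (2024) 778–782 [BravyiEtAl2024], Table 1 (p. 780; `paper:url-cd30d32baa9f` p0003 L78–82:
"`[[72,12,6]] 1/12 … [[90,8,10]] 1/23 … [[108,8,10]] 1/27 … [[144,12,12]] 1/24 … [[288,12,18]] 1/48`")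
and Extended Data Table 1 (= arXiv:2308.07915 Table 3), whose caption (p0011 L6–7) reads "Code
distance was computed by the mixed integer programming approach of ref. 68. The notation `≤d`
indicates that only an upper bound on the code distance is known at the time of this writing." — a
solver computation, no certificate in print ⇒ column word CLAIM. The codes themselves (`ℓ, m, A, B`)
are the tree's DATA `Literature.InformationTheory.QuantumCodes.BB.bb72 … bb288`
(`BivariateBicycleCodes.lean`, locators there).

* `HasParams C n k d` — "`QC(A, B)` has parameters `[[n, k, d]]`": `n = BB.numQubits ℓ m` (`= 2ℓm`),
  `k = C.k` (the CSS dimension `n − rk H^X − rk H^Z`, `CSSCode.k`), `d = C.d = min (d^X, d^Z)`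
  (`= d^X = d^Z`, Lemma 1, proved in the tree). `d` EXACT (not a lower bound).
* `BB72_12_6_claim`, `BB90_8_10_claim`, `BB108_8_10_claim`, `BB144_12_12_claim`, `BB288_12_18_claim`
  — CLAIM as printed; certificate: pending (qec census row ids `BB72`, …; kernels A/B, search-7 emitter).
* `hasParams_of_dX`, `hasParams_of_dZ` — the discharge interface: `n` by counting, `k` and ONE of
  `d^X = d` / `d^Z = d` (a `CSSCode.dX_eq_of_witness`-shaped certificate) give the claim.
* `numQubits_bb*` — the `n`-components hold by counting (this certifies nothing about `k` or `d`).
-/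

namespace Summit.Ventures.QEC.BB

open Literature.InformationTheory.QuantumCodes

/-- "The code `QC(A, B)` has parameters `[[n, k, d]]`": `n` data qubits (`BB.numQubits ℓ m = 2ℓm`),
`k` logical qubits (`BB.Code.k` = the CSS dimension `n − rk H^X − rk H^Z`) and distance EXACTLY `d`
(`BB.Code.d = min (d^X, d^Z)`, the least weight of a logical operator; `= d^X = d^Z` by Lemma 1 of
[BravyiEtAl2024]). The census row predicate for family BB (definition; the phrase "the code `QC(A, B)` has
parameters `[[n, k, d]]`" of Lemma 1). [cite: BravyiEtAl2024, Lemma 1 (arXiv:2308.07915 chunk p0009 L68 "has parameters [[n,k,d]]")] -/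
def HasParams {ℓ m : ℕ} [NeZero ℓ] [NeZero m] (C : BB.Code ℓ m) (n k d : ℕ) : Prop :=
  BB.numQubits ℓ m = n ∧ C.k = k ∧ C.d = d

/-- **CLAIM as printed** — the bivariate-bicycle code `QC(x³+y+y², y³+x+x²)` on `ℤ₆ × ℤ₆`
(`BB.bb72`) has parameters `[[72, 12, 6]]` (Nature 627 Table 1, p. 780, `paper:url-cd30d32baa9f`
p0003 L78: "`[[72, 12, 6]] 1/12 ≤6 0.0048 …`"; distance "computed by the mixed integer programming
approach", ED Table 1 caption p0011 L6). Certificate: pending (qec census row `BB72`).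
[cite: BravyiEtAl2024, Table 1 row [[72,12,6]] and Extended Data Table 1] -/
@[conjecture] def BB72_12_6_claim : Prop := HasParams BB.bb72 72 12 6

/-- **CLAIM as printed** — `QC(x⁹+y+y², 1+x²+x⁷)` on `ℤ₁₅ × ℤ₃` (`BB.bb90`) has parameters
`[[90, 8, 10]]` (Nature 627 Table 1 p0003 L79: "`[[90, 8, 10]] 1/23 ≤8 0.0053 …`"; distance by MIP,
ED Table 1 caption p0011 L6). Certificate: pending (row `BB90`).
[cite: BravyiEtAl2024, Table 1 row [[90,8,10]] and Extended Data Table 1] -/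
@[conjecture] def BB90_8_10_claim : Prop := HasParams BB.bb90 90 8 10

/-- **CLAIM as printed** — `QC(x³+y+y², y³+x+x²)` on `ℤ₉ × ℤ₆` (`BB.bb108`) has parameters
`[[108, 8, 10]]` (Nature 627 Table 1 p0003 L80: "`[[108, 8, 10]] 1/27 ≤8 0.0058 …`"; distance by MIP,
ED Table 1 caption p0011 L6). Certificate: pending (row `BB108`).
[cite: BravyiEtAl2024, Table 1 row [[108,8,10]] and Extended Data Table 1] -/
@[conjecture] def BB108_8_10_claim : Prop := HasParams BB.bb108 108 8 10

/-- **CLAIM as printed** — the "gross" code `QC(x³+y+y², y³+x+x²)` on `ℤ₁₂ × ℤ₆` (`BB.bb144`) has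
parameters `[[144, 12, 12]]` (Nature 627 Table 1 p0003 L81: "`[[144, 12, 12]] 1/24 ≤10 0.0065 …`";
"The distance-12 code `[[144,12,12]]`", p. 779; distance by MIP, ED Table 1 caption p0011 L6).
Certificate: pending (row `BB144`).
[cite: BravyiEtAl2024, Table 1 row [[144,12,12]] and Extended Data Table 1] -/
@[conjecture] def BB144_12_12_claim : Prop := HasParams BB.bb144 144 12 12

/-- **CLAIM as printed** — `QC(x³+y²+y⁷, y³+x+x²)` on `ℤ₁₂ × ℤ₁₂` (`BB.bb288`) has parameters
`[[288, 12, 18]]` (Nature 627 Table 1 p0003 L82: "`[[288, 12, 18]] 1/48 ≤18 0.0069 …`"; distance by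
MIP, ED Table 1 caption p0011 L6). Certificate: pending (row `BB288`; the qec pre-registration lists
the lower bound `d ≥ 18` as external-solver-only for now).
[cite: BravyiEtAl2024, Table 1 row [[288,12,18]] and Extended Data Table 1] -/
@[conjecture] def BB288_12_18_claim : Prop := HasParams BB.bb288 288 12 18

section Discharge

variable {ℓ m : ℕ} [NeZero ℓ] [NeZero m] {C : BB.Code ℓ m} {n k d : ℕ}

/-- Discharge interface (`X` side): the qubit count, the dimension and an `X`-distance certificate
`d^X = d` prove `[[n, k, d]]` — because `d = d^X` for every `QC(A, B)` (Lemma 1, `BB.Code.d_eq_dX`).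
(proved) -/
theorem hasParams_of_dX (hn : BB.numQubits ℓ m = n) (hk : C.k = k) (hd : C.css.dX = d) :
    HasParams C n k d :=
  ⟨hn, hk, C.d_eq_dX.trans hd⟩

/-- Discharge interface (`Z` side): `d^Z = d` suffices likewise (`BB.Code.d_eq_dZ`). (proved) -/
theorem hasParams_of_dZ (hn : BB.numQubits ℓ m = n) (hk : C.k = k) (hd : C.css.dZ = d) :
    HasParams C n k d :=
  ⟨hn, hk, C.d_eq_dZ.trans hd⟩

/-- Conversely a proved row yields both one-sided distances. (proved) -/
theorem dX_eq_of_hasParams (h : HasParams C n k d) : C.css.dX = d ∧ C.css.dZ = d :=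
  ⟨C.d_eq_dX.symm.trans h.2.2, C.d_eq_dZ.symm.trans h.2.2⟩

end Discharge

/-- The `n`-component of the five claims holds by counting (`n = 2ℓm`); this certifies nothing about
`k` or `d`. (proved) -/
theorem numQubits_claims : BB.numQubits 6 6 = 72 ∧ BB.numQubits 15 3 = 90 ∧ BB.numQubits 9 6 = 108 ∧
    BB.numQubits 12 6 = 144 ∧ BB.numQubits 12 12 = 288 :=
  BB.numQubits_instances

end Summit.Ventures.QEC.BB

/-! ### Equivalence with the generic CSS row predicate `CSSCode.IsCode` (appended 2026-08-26)

`CSSParameters.lean` (qec PARTITION v2 D2.2) fixes the census row predicate for every CSS code as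
`CSSCode.IsCode C n k d := |Q| = n ∧ C.k = k ∧ cssMinDist C.HX C.HZ = ↑d`. For a BB code the two
predicates say the same thing: `HasParams C n k d ↔ C.css.IsCode n k d` whenever `k > 0` (for `k = 0`
no `IsCode` row exists — `cssMinDist = ⊤` — while `HasParams _ n 0 0` is the junk row); in particular
each of the five claims is LITERALLY equivalent to the corresponding `IsCode` row, so a certificate may
discharge either form. -/

namespace Summit.Ventures.QEC.BB

open Literature.InformationTheory.QuantumCodes

section IsCode

variable {ℓ m : ℕ} [NeZero ℓ] [NeZero m] {C : BB.Code ℓ m} {n k d : ℕ}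

/-- `HasParams` is the generic CSS row predicate `CSSCode.IsCode` of `C.css`, given `0 < C.k`
(unfolding: `BB.numQubits ℓ m = |Mono ⊕ Mono|`, `C.k = C.css.k`, `C.d = min (d^X, d^Z)` and
`cssMinDist = ↑(min (d^X, d^Z))` for `k > 0`). (proved) -/
theorem hasParams_iff_isCode_of_pos (hk : 0 < C.k) : HasParams C n k d ↔ C.css.IsCode n k d :=
  (C.css.isCode_iff hk).symm

/-- For a row with `k > 0` (all published rows), `HasParams C n k d ↔ C.css.IsCode n k d`. (proved) -/
theorem hasParams_iff_isCode (hk : 0 < k) : HasParams C n k d ↔ C.css.IsCode n k d := by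
  constructor
  · intro h
    have hk' : 0 < C.k := by rw [show C.k = k from h.2.1]; exact hk
    exact (hasParams_iff_isCode_of_pos hk').1 h
  · intro h
    have hk' : 0 < C.css.k := by rw [show C.css.k = k from h.2.1]; exact hk
    exact (hasParams_iff_isCode_of_pos hk').2 h

end IsCode

/-- `[[72,12,6]]` CLAIM ↔ the generic row `BB.bb72.css.IsCode 72 12 6`. (proved)
[cite: BravyiEtAl2024, Table 1 row [[72,12,6]]] -/
theorem BB72_12_6_claim_iff : BB72_12_6_claim ↔ BB.bb72.css.IsCode 72 12 6 :=
  hasParams_iff_isCode (by decide)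

/-- `[[90,8,10]]` CLAIM ↔ `BB.bb90.css.IsCode 90 8 10`. (proved) [cite: BravyiEtAl2024, Table 1 row [[90,8,10]]] -/
theorem BB90_8_10_claim_iff : BB90_8_10_claim ↔ BB.bb90.css.IsCode 90 8 10 :=
  hasParams_iff_isCode (by decide)

/-- `[[108,8,10]]` CLAIM ↔ `BB.bb108.css.IsCode 108 8 10`. (proved) [cite: BravyiEtAl2024, Table 1 row [[108,8,10]]] -/
theorem BB108_8_10_claim_iff : BB108_8_10_claim ↔ BB.bb108.css.IsCode 108 8 10 :=
  hasParams_iff_isCode (by decide)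

/-- `[[144,12,12]]` CLAIM ↔ `BB.bb144.css.IsCode 144 12 12`. (proved) [cite: BravyiEtAl2024, Table 1 row [[144,12,12]]] -/
theorem BB144_12_12_claim_iff : BB144_12_12_claim ↔ BB.bb144.css.IsCode 144 12 12 :=
  hasParams_iff_isCode (by decide)

/-- `[[288,12,18]]` CLAIM ↔ `BB.bb288.css.IsCode 288 12 18`. (proved) [cite: BravyiEtAl2024, Table 1 row [[288,12,18]]] -/
theorem BB288_12_18_claim_iff : BB288_12_18_claim ↔ BB.bb288.css.IsCode 288 12 18 :=
  hasParams_iff_isCode (by decide)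

end Summit.Ventures.QEC.BB
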